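import Literature.Topology.FourManifolds.LeeRasmussenMirrorProofs
import Literature.Topology.FourManifolds.KhComplexFaceProofs
import Literature.Topology.FourManifolds.KhResolutionsDichotomyProofs
import Literature.Topology.FourManifolds.LeeRasmussenRankProofs
import Literature.Topology.FourManifolds.LeeRasmussenMinMaxProofs
import Literature.Topology.FourManifolds.RegularProjectionParity
import HarnessLib

/-!
# `s(K̄) = -s(K)`: discharge of `rasmussenInvariant_mirror`

Sibling proof file of `LeeRasmussen.lean` and `LeeRasmussenMirrorProofs.lean` (topic
`Literature/Topology/FourManifolds`). It closes the named fact
`Literature.Topology.FourManifolds.GaussDiagram.rasmussenInvariant_mirror` (**the Rasmussen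
invariant of the mirror of a knot diagram is `-s`**; Rasmussen (2010), Prop. 3.9) by assembling
results already in the tree:

* `LeeRasmussenMirrorProofs.rasmussenInvariant_mirror_of` — the Lee complex of the mirror diagram
  `Ḡ` is the dual filtered complex, so `s(Ḡ) = -s(G)` follows from `d² = 0` (over `ℚ`) and
  `s_max = s_min + 2` (Rasmussen (2010), proof of Prop. 3.9; Lemma 3.10);
* `KhComplexFaceProofs.khovanovD_comp_khovanovD_of_dichotomy` — `d² = 0` (Khovanov (2000), Prop. 8)
  from the merge/split dichotomy of the edges of the cube of resolutions;
* `LeeRasmussenRankProofs.finrank_leeHomologyZero_eq_two_of_dichotomy` — Lee's rank-two theorem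
  (Lee (2005), Thm. 4.2) from the dichotomy, and
  `LeeRasmussenMinMaxProofs.leeSMax_eq_leeSMin_add_two_of_finrank` — Rasmussen's
  `s_max = s_min + 2` (Rasmussen (2010), Prop. 3.3) from Lee's theorem;
* `KhResolutionsDichotomyProofs.isMergeAt_or_isSplitAt_of_overPos_mod_two_ne` — the dichotomy
  from Gauss's parity condition on the Gauss diagram, and
  `RegularProjectionParity`'s `Knot.RegularProjection.overPos_mod_two_ne_underPos_mod_two` —
  **Gauss's parity condition holds for regular projections of knots** (C. F. Gauss, *Werke* VIII,
  pp. 272, 282–286; Kauffman (1999), §3.2, Lemma 1), the only place where planarity enters.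

Main results: `rasmussenInvariant_mirror_of_dichotomy`, `rasmussenInvariant_mirror_of_parity`
(the conditional forms) and the discharge `rasmussenInvariant_mirror_holds`. No definition and
no named fact is introduced.

## References

* J. Rasmussen, *Khovanov homology and the slice genus*, Invent. Math. 182 (2010) 419–447
  (arXiv:math/0402131), §3.2, Prop. 3.9 (`s_max(K̄) = -s_min(K)`, `s_min(K̄) = -s_max(K)`,
  `s(K̄) = -s(K)`), Prop. 3.3 (`s_max = s_min + 2`). [cite: Rasmussen2010, Prop. 3.9]
* E. S. Lee, *An endomorphism of the Khovanov invariant*, Adv. Math. 197 (2005) 554–586,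
  Thm. 4.2. [cite: Lee2005, Thm. 4.2]
* M. Khovanov, *A categorification of the Jones polynomial*, Duke Math. J. 101 (2000) 359–426,
  Prop. 8, §7.3 (mirror image and the dual complex). [cite: Khovanov2000, Prop. 8]
* L. H. Kauffman, *Virtual knot theory*, European J. Combin. 20 (1999) 663–690, §3.2, Lemma 1
  (planar Gauss codes are evenly intersticed). [cite: Kauffman1999, §3.2 Lemma 1]
-/

noncomputable section

namespace Literature.Topology.FourManifolds

namespace GaussDiagram

/-- **Mirror image: `s(K̄) = -s(K)`, reduced to the merge/split dichotomy.** The named fact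
`rasmussenInvariant_mirror` follows from the conclusion of the named fact
`isMergeAt_or_isSplitAt_of_hasGaussDiagram` of `KhResolutions` (every edge of the cube of
resolutions of a realisable Gauss diagram is a merge or a split), for every Gauss diagram:
`d² = 0` is `khovanovD_comp_khovanovD_of_dichotomy` (Khovanov (2000), Prop. 8), Lee's rank-two
theorem is `finrank_leeHomologyZero_eq_two_of_dichotomy` (Lee (2005), Thm. 4.2), Rasmussen's
`s_max = s_min + 2` is `leeSMax_eq_leeSMin_add_two_of_finrank` (Rasmussen (2010), Prop. 3.3), and
the duality is `rasmussenInvariant_mirror_of`. [cite: Rasmussen2010, Prop. 3.9] -/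
theorem rasmussenInvariant_mirror_of_dichotomy
    (hD : ∀ G : GaussDiagram, isMergeAt_or_isSplitAt_of_hasGaussDiagram (G := G)) :
    rasmussenInvariant_mirror :=
  rasmussenInvariant_mirror_of (fun G ↦ khovanovD_comp_khovanovD_of_dichotomy G ℚ (hD G))
    (leeSMax_eq_leeSMin_add_two_of_finrank (finrank_leeHomologyZero_eq_two_of_dichotomy hD))

/-- **Mirror image: `s(K̄) = -s(K)`, reduced to Gauss's parity condition.** If in every regular
projection of every knot each crossing is passed over and under at positions of opposite parity
(Gauss's parity condition for closed normal plane curves: the crossing sequence is evenly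
intersticed; C. F. Gauss, *Werke* VIII, pp. 272, 282–286; Kauffman (1999), §3.2, Lemma 1), then
`s(Ḡ) = -s(G)` for every realisable Gauss diagram `G`: the parity condition gives the merge/split
dichotomy (`isMergeAt_or_isSplitAt_of_overPos_mod_two_ne`, `KhResolutionsDichotomyProofs`), and
`rasmussenInvariant_mirror_of_dichotomy` applies. [cite: Rasmussen2010, Prop. 3.9] -/
theorem rasmussenInvariant_mirror_of_parity
    (hpar : ∀ {K : Knot} (P : K.RegularProjection) (j : Fin P.diagram.n),
      (P.diagram.overPos j).val % 2 ≠ (P.diagram.underPos j).val % 2) :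
    rasmussenInvariant_mirror := by
  refine rasmussenInvariant_mirror_of_dichotomy fun G ↦ ?_
  intro σ i hG hσ
  obtain ⟨K, P, rfl⟩ := hG
  exact isMergeAt_or_isSplitAt_of_overPos_mod_two_ne (fun j ↦ hpar P j) hσ

/-- **Mirror image: `s(K̄) = -s(K)`** — discharge of the named fact `rasmussenInvariant_mirror`
of `LeeRasmussen`: for every Gauss diagram `G` realised by a knot, the Rasmussen invariant of the
mirror diagram is `s(Ḡ) = -s(G)`. Gauss's parity condition holds for regular projections of knots
(`Knot.RegularProjection.overPos_mod_two_ne_underPos_mod_two`, `RegularProjectionParity`;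
Kauffman (1999), §3.2, Lemma 1), so `rasmussenInvariant_mirror_of_parity` applies: parity gives
the merge/split dichotomy, hence `d² = 0` and Lee's rank-two theorem, hence `s_max = s_min + 2`
(Rasmussen (2010), Prop. 3.3), and the Lee complex of `Ḡ` is the dual filtered complex
(Rasmussen (2010), Prop. 3.9: `s_max(K̄) = -s_min(K)`, `s(K̄) = -s(K)`).
[cite: Rasmussen2010, Prop. 3.9] -/
theorem rasmussenInvariant_mirror_holds : rasmussenInvariant_mirror :=
  rasmussenInvariant_mirror_of_parity fun P j ↦ P.overPos_mod_two_ne_underPos_mod_two j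

end GaussDiagram

end Literature.Topology.FourManifolds
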